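import Mathlib
import Literature.Analysis.UnboundedOperators.ConjugateOperatorRegularity
import Literature.Analysis.UnboundedOperators.UnitaryRepSpectralMeasure
import Literature.Analysis.UnboundedOperators.FourierSpectrumCalculus
import HarnessLib
import Summits.AtomisticToContinuum.FouriersLaw.Theorems.EmbeddedDrudeMourreMourreDissolutionLAPCalculus

/-!
# Stub `stub_mourreThresholdLAP` — Mourre LAP infrastructure 4/4: localisation in energy

Item `stmt-AtomisticToContinuum-12594` (crux `MourreDissolution` of route `EmbeddedDrudeMourre`,
sub-problem `FouriersLaw`), line `separable-vertex-faddeev-pair-sector`, stub S6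
`stub_mourreThresholdLAP` = the limiting absorption principle of Mourre theory (ABG Thm 7.4.1 in
its gap-free `𝒞^{1,1}` form, Sahbani 1997, plus the virial theorem ABG Prop. 7.2.10) over the
tree's vocabulary (`OneParameterUnitaryGroup`, `fourierCalculus`, `HasMourreEstimateOn`,
`HamiltonianOfClassC1/C11`, `spectralMeasure`). The theorem itself is NOT in the tree; these files
(`…LAPSpectralDictionary`, `…LAPVirial`, `…LAPCalculus`, `…LAPLocalisation`) are the sorry-free
bottom of the chain (Mourre LAP infrastructure), reusable by every consumer of the abstract
Mourre `⇒` LAP statement (e.g. route `MourreKoopmanCharges` of `HydrodynamicLimit`).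

This file (part 4, over parts 1–3) is the "far from the window" half of the localisation step:

* §1 the trivial part of the LAP: if `μ_ψ` does not charge `(l' - η, r' + η)` then
  `G_ν → G₀` uniformly on `[l', r']` as `ν ↓ 0`, with the explicit rate `ν‖ψ‖²/η²`;
* §2 spectral measures of cut-off vectors: all matrix coefficients of `w = aψ + g(H/2π)ψ`, hence
  (uniqueness of the Stone–Bochner measure) `μ_w = |a + g(·/2π)|² μ_ψ`, so `μ_w` vanishes where the
  symbol `a + g(·/2π)` vanishes — with §1 this closes the piece `⟨w, R(z)w⟩`, `w = ψ - φ²(H)ψ`.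
-/

noncomputable section

open MeasureTheory Complex Filter Topology Set
open scoped InnerProductSpace ComplexConjugate SchwartzMap FourierTransform ENNReal NNReal

namespace Summit.AtomisticToContinuum.FouriersLaw.Theorems.MourreDissolution

open Literature.Analysis.UnboundedOperators
open Literature.Analysis.UnboundedOperators.UnitaryRep

variable {H : Type*} [NormedAddCommGroup H] [InnerProductSpace ℂ H] [CompleteSpace H]

/-! ## §1. The trivial part of the LAP: uniform convergence off the spectral support -/

/-- The Cauchy kernels at `ν > 0` and `ν = 0` differ by at most `ν/η²` at distance `≥ η` from the
pole: `‖1/(ν + iy) - 1/(iy)‖ ≤ ν / η²` for `|y| ≥ η > 0`. [folklore] -/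
theorem norm_one_div_cauchy_sub_le {ν η y : ℝ} (hν : 0 < ν) (hη : 0 < η) (hy : η ≤ |y|) :
    ‖1 / ((ν : ℂ) + I * (y : ℂ)) - 1 / (I * (y : ℂ))‖ ≤ ν / η ^ 2 := by
  have hy0 : y ≠ 0 := fun h => by rw [h, abs_zero] at hy; linarith
  have hIy : I * (y : ℂ) ≠ 0 := mul_ne_zero Complex.I_ne_zero (Complex.ofReal_ne_zero.2 hy0)
  have hνy : (ν : ℂ) + I * (y : ℂ) ≠ 0 := fun h => by
    have := congrArg Complex.re h
    simp at this
    exact hν.ne' this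
  have hy' : (y : ℂ) ≠ 0 := Complex.ofReal_ne_zero.2 hy0
  have heq : 1 / ((ν : ℂ) + I * (y : ℂ)) - 1 / (I * (y : ℂ)) =
      -(ν : ℂ) / (((ν : ℂ) + I * (y : ℂ)) * (I * (y : ℂ))) := by
    rw [div_sub_div _ _ hνy hIy, one_mul, mul_one]
    congr 1
    ring
  rw [heq, norm_div, norm_neg, Complex.norm_real, Real.norm_eq_abs, abs_of_pos hν, norm_mul]
  have h1 : η ≤ ‖(ν : ℂ) + I * (y : ℂ)‖ := by
    calc η ≤ |y| := hy
      _ = |((ν : ℂ) + I * (y : ℂ)).im| := by simp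
      _ ≤ ‖(ν : ℂ) + I * (y : ℂ)‖ := Complex.abs_im_le_norm _
  have h2 : η ≤ ‖I * (y : ℂ)‖ := by
    rw [norm_mul, Complex.norm_I, one_mul, Complex.norm_real, Real.norm_eq_abs]
    exact hy
  refine div_le_div_of_nonneg_left hν.le (by positivity) ?_
  rw [sq]
  exact mul_le_mul h1 h2 hη.le (norm_nonneg _)


/-- Off the `η`-neighbourhood of `[l', r']` the limiting kernel `1/(i(ω - ξ))`, `ω ∈ [l', r']`, is
bounded by `1/η`, hence integrable against `μ` when `μ` does not charge that neighbourhood.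
[folklore] -/
theorem integrable_one_div_cauchy_zero_aux (μ : Measure ℝ) [IsFiniteMeasure μ] {l' r' η : ℝ}
    (hae : ∀ᵐ ξ ∂μ, ξ ∉ Set.Ioo (l' - η) (r' + η)) (hη : 0 < η) {ω : ℝ} (hω : ω ∈ Set.Icc l' r') :
    Integrable (fun ξ : ℝ => 1 / (I * ((ω - ξ : ℝ) : ℂ))) μ := by
  refine Integrable.of_bound (C := 1 / η) ?_ ?_
  · exact (Measurable.aestronglyMeasurable (by fun_prop))
  · filter_upwards [hae] with ξ hξ
    simp only [Set.mem_Ioo, not_and_or, not_lt] at hξ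
    have hy : η ≤ |ω - ξ| := by
      rcases hξ with h | h
      · rw [abs_of_nonneg (by linarith [hω.1])]; linarith [hω.1]
      · rw [abs_of_nonpos (by linarith [hω.2])]; linarith [hω.2]
    rw [norm_div, norm_one, norm_mul, Complex.norm_I, one_mul, Complex.norm_real, Real.norm_eq_abs]
    exact one_div_le_one_div_of_le hη hy

/-- **The LAP is trivial off the spectral support**: if `μ_ψ` does not charge the
`η`-neighbourhood `(l' - η, r' + η)` of `[l', r']`, then
`G_ν(ω) = ∫ dμ_ψ/(ν + i(ω - ξ)) → ∫ dμ_ψ/(i(ω - ξ))` uniformly on `[l', r']` as `ν ↓ 0`, with the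
explicit rate `‖G_ν(ω) - G₀(ω)‖ ≤ (ν/η²)‖ψ‖²`. (The piece `⟨ψ, R(z)(1 - φ²(H))ψ⟩` of the
localisation step L6 is of this form.) [folklore] -/
theorem tendstoUniformlyOn_laplaceFourier_of_specMeasure_null (U : OneParameterUnitaryGroup H)
    (ψ : H) {l' r' η : ℝ} (hη : 0 < η)
    (hnull : specMeasure U ψ (Set.Ioo (l' - η) (r' + η)) = 0) :
    TendstoUniformlyOn (fun ν ω => laplaceFourier U ψ ν ω)
      (fun ω => ∫ ξ, 1 / (I * ((ω - ξ : ℝ) : ℂ)) ∂(specMeasure U ψ)) (𝓝[>] (0:ℝ)) (Set.Icc l' r') := by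
  set μ := specMeasure U ψ with hμ
  have hae : ∀ᵐ ξ ∂μ, ξ ∉ Set.Ioo (l' - η) (r' + η) := (measure_eq_zero_iff_ae_notMem.1 hnull)
  rw [Metric.tendstoUniformlyOn_iff]
  intro ε hε
  -- choose `ν < ε η² / (‖ψ‖² + 1)`
  have hpos : 0 < ε * η ^ 2 / (‖ψ‖ ^ 2 + 1) := by positivity
  filter_upwards [self_mem_nhdsWithin, Ioo_mem_nhdsGT hpos] with ν hν hν'
  intro ω hω
  have hν0 : 0 < ν := hν
  rw [laplaceFourier_eq_integral_specMeasure U ψ hν0 ω, dist_eq_norm,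
    ← integral_sub (integrable_one_div_cauchy_zero_aux μ hae hη hω) (integrable_one_div_cauchy μ hν0 ω)]
  have hbound : ∀ᵐ ξ ∂μ, ‖1 / (I * ((ω - ξ : ℝ) : ℂ)) - 1 / ((ν : ℂ) + I * ((ω - ξ : ℝ) : ℂ))‖ ≤
      ν / η ^ 2 := by
    filter_upwards [hae] with ξ hξ
    rw [norm_sub_rev]
    refine norm_one_div_cauchy_sub_le hν0 hη ?_
    simp only [Set.mem_Ioo, not_and_or, not_lt] at hξ
    rcases hξ with h | h
    · rw [abs_of_nonneg (by linarith [hω.1])]; linarith [hω.1]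
    · rw [abs_of_nonpos (by linarith [hω.2])]; linarith [hω.2]
  calc ‖∫ ξ, (1 / (I * ((ω - ξ : ℝ) : ℂ)) - 1 / ((ν : ℂ) + I * ((ω - ξ : ℝ) : ℂ))) ∂μ‖
      ≤ ν / η ^ 2 * μ.real univ := norm_integral_le_of_norm_le_const hbound
    _ = ν / η ^ 2 * ‖ψ‖ ^ 2 := by rw [hμ, specMeasure_real_univ]
    _ < ε := by
        rw [div_mul_eq_mul_div, div_lt_iff₀ (by positivity)]
        have h1 : ν < ε * η ^ 2 / (‖ψ‖ ^ 2 + 1) := hν'.2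
        rw [lt_div_iff₀ (by positivity)] at h1
        nlinarith [sq_nonneg ‖ψ‖, hε, sq_nonneg η]


/-- **The LAP is trivial off the spectral support, headline form** (all binders explicit;
registered helper stub of `stub_mourreThresholdLAP`): if `μ_ψ` does not charge
`(l' - η, r' + η)`, `η > 0`, then `G_ν → ∫ dμ_ψ(ξ)/(i(ω - ξ))` uniformly on `[l', r']` as `ν ↓ 0`.
[folklore] -/
theorem lapFar_tendstoUniformlyOn_of_specMeasure_null :
    ∀ (K : Type) [NormedAddCommGroup K] [InnerProductSpace ℂ K] [CompleteSpace K]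
      (U : Literature.Analysis.UnboundedOperators.OneParameterUnitaryGroup K) (ψ : K) (l' r' η : ℝ),
      0 < η →
      Summit.AtomisticToContinuum.FouriersLaw.Theorems.MourreDissolution.specMeasure U ψ
          (Set.Ioo (l' - η) (r' + η)) = 0 →
        TendstoUniformlyOn
          (fun (ν : ℝ) (ω : ℝ) =>
            Summit.AtomisticToContinuum.FouriersLaw.Theorems.MourreDissolution.laplaceFourier U ψ ν ω)
          (fun ω : ℝ => MeasureTheory.integral
            (Summit.AtomisticToContinuum.FouriersLaw.Theorems.MourreDissolution.specMeasure U ψ)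
            (fun ξ : ℝ => 1 / (Complex.I * ((ω - ξ : ℝ) : ℂ))))
          (nhdsWithin (0:ℝ) (Set.Ioi 0)) (Set.Icc l' r') := by
  intro K _ _ _ U ψ l' r' η hη hnull
  exact tendstoUniformlyOn_laplaceFourier_of_specMeasure_null U ψ hη hnull

/-! ## §2. Spectral measures of cut-off vectors: `μ_{aψ + g(H/2π)ψ} = |a + g(·/2π)|² μ_ψ` -/

/-- Integrability of `(a, ξ) ↦ 𝓕g(a) e^{iξa} e^{iξx}` on `ℝ × (ℝ, μ)`, `μ` finite. [folklore] -/
theorem integrable_fourier_kernel_prod' (μ : Measure ℝ) [IsFiniteMeasure μ] (g : 𝓢(ℝ, ℂ)) (x : ℝ) :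
    Integrable (Function.uncurry fun (a ξ : ℝ) =>
        (𝓕 g : 𝓢(ℝ, ℂ)) a * cexp (((ξ * a : ℝ) : ℂ) * I) * cexp (((ξ * x : ℝ) : ℂ) * I))
      ((volume : Measure ℝ).prod μ) := by
  have h1 : Integrable (fun z : ℝ × ℝ => ‖(𝓕 g : 𝓢(ℝ, ℂ)) z.1‖ * (1 : ℝ)) ((volume : Measure ℝ).prod μ) :=
    ((𝓕 g : 𝓢(ℝ, ℂ)).integrable.norm).mul_prod (integrable_const (1 : ℝ))
  refine h1.mono' (Continuous.aestronglyMeasurable ?_) (ae_of_all _ (fun z => ?_))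
  · exact (((𝓕 g : 𝓢(ℝ, ℂ)).continuous.comp continuous_fst).mul (by fun_prop)).mul (by fun_prop)
  · change ‖(𝓕 g : 𝓢(ℝ, ℂ)) z.1 * cexp (((z.2 * z.1 : ℝ) : ℂ) * I) * cexp (((z.2 * x : ℝ) : ℂ) * I)‖ ≤
      ‖(𝓕 g : 𝓢(ℝ, ℂ)) z.1‖ * 1
    rw [norm_mul, norm_mul, Complex.norm_exp, Complex.norm_exp]
    have h3 : ((((z.2 * z.1 : ℝ) : ℂ)) * I).re = 0 := by simp
    have h4 : ((((z.2 * x : ℝ) : ℂ)) * I).re = 0 := by simp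
    rw [h3, h4, Real.exp_zero, mul_one]

/-- **Off-diagonal coefficient of a cut-off vector**: `⟪ψ, U_x g(H/2π) ψ⟫ = ∫ e^{iξx} g(ξ/2π) dμ_ψ(ξ)`.
[folklore] -/
theorem inner_appReal_fourierCalculus_eq_integral (U : OneParameterUnitaryGroup H) (g : 𝓢(ℝ, ℂ))
    (ψ : H) (x : ℝ) :
    ⟪ψ, U.appReal x (U.fourierCalculus g ψ)⟫_ℂ =
      ∫ ξ, cexp (((ξ * x : ℝ) : ℂ) * I) * g (ξ / (2 * Real.pi)) ∂(specMeasure U ψ) := by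
  have hk : Integrable ((𝓕 g : 𝓢(ℝ, ℂ)) : ℝ → ℂ) := (𝓕 g : 𝓢(ℝ, ℂ)).integrable
  rw [fourierCalculus_apply, U.appReal_apply_integral_smul_appReal' hk ψ x,
    inner_integral_smul_appReal U hk]
  have hint := integrable_fourier_kernel_prod' (specMeasure U ψ) g x
  calc ∫ a, (𝓕 g : 𝓢(ℝ, ℂ)) a * ⟪ψ, U.appReal a (U.appReal x ψ)⟫_ℂ
      = ∫ a, ∫ ξ, (𝓕 g : 𝓢(ℝ, ℂ)) a * cexp (((ξ * a : ℝ) : ℂ) * I) * cexp (((ξ * x : ℝ) : ℂ) * I)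
          ∂(specMeasure U ψ) := by
        refine integral_congr_ae (ae_of_all _ fun a => ?_)
        simp only
        rw [← mul_apply_eq_comp, ← appReal_add, inner_appReal_eq_integral_specMeasure,
          ← integral_const_mul]
        refine integral_congr_ae (ae_of_all _ fun ξ => ?_)
        simp only
        rw [mul_assoc, ← Complex.exp_add]
        congr 2
        push_cast
        ring
    _ = ∫ ξ, (∫ a, (𝓕 g : 𝓢(ℝ, ℂ)) a * cexp (((ξ * a : ℝ) : ℂ) * I) * cexp (((ξ * x : ℝ) : ℂ) * I))
          ∂(specMeasure U ψ) := integral_integral_swap hint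
    _ = ∫ ξ, cexp (((ξ * x : ℝ) : ℂ) * I) * g (ξ / (2 * Real.pi)) ∂(specMeasure U ψ) := by
        refine integral_congr_ae (ae_of_all _ fun ξ => ?_)
        simp only
        rw [integral_mul_const, integral_fourier_mul_cexp, mul_comm]

/-- **Diagonal coefficient of a cut-off vector**:
`⟪g(H/2π)ψ, U_x g(H/2π)ψ⟫ = ∫ e^{iξx} |g(ξ/2π)|² dμ_ψ(ξ)`. [folklore] -/
theorem inner_fourierCalculus_appReal_fourierCalculus_eq_integral (U : OneParameterUnitaryGroup H)
    (g : 𝓢(ℝ, ℂ)) (ψ : H) (x : ℝ) :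
    ⟪U.fourierCalculus g ψ, U.appReal x (U.fourierCalculus g ψ)⟫_ℂ =
      ∫ ξ, cexp (((ξ * x : ℝ) : ℂ) * I) * (conj (g (ξ / (2 * Real.pi))) * g (ξ / (2 * Real.pi)))
        ∂(specMeasure U ψ) := by
  obtain ⟨gc, hgc⟩ := exists_schwartz_conj g
  have hk : Integrable ((𝓕 g : 𝓢(ℝ, ℂ)) : ℝ → ℂ) := (𝓕 g : 𝓢(ℝ, ℂ)).integrable
  have hk' : Integrable ((𝓕 (SchwartzMap.smulLeftCLM ℂ (gc : ℝ → ℂ) g) : 𝓢(ℝ, ℂ)) : ℝ → ℂ) :=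
    (𝓕 _ : 𝓢(ℝ, ℂ)).integrable
  have h1 : ⟪U.fourierCalculus g ψ, U.appReal x (U.fourierCalculus g ψ)⟫_ℂ =
      ⟪ψ, U.appReal x (U.fourierCalculus (SchwartzMap.smulLeftCLM ℂ (gc : ℝ → ℂ) g) ψ)⟫_ℂ := by
    rw [fourierCalculus_apply, fourierCalculus_apply, U.appReal_apply_integral_smul_appReal' hk ψ x,
      U.inner_integral_fourier_integral_fourier hgc g ψ (U.appReal x ψ),
      ← U.appReal_apply_integral_smul_appReal' hk' ψ x]
  rw [h1, inner_appReal_fourierCalculus_eq_integral]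
  refine integral_congr_ae (ae_of_all _ fun ξ => ?_)
  simp only
  rw [SchwartzMap.smulLeftCLM_apply_apply gc.hasTemperateGrowth, hgc, smul_eq_mul]

/-- **All coefficients of `w = aψ + g(H/2π)ψ`**: `⟪w, U_x w⟫ = ∫ e^{iξx} |a + g(ξ/2π)|² dμ_ψ(ξ)`.
[folklore] -/
theorem inner_appReal_smul_add_fourierCalculus (U : OneParameterUnitaryGroup H) (ψ : H) (a : ℂ)
    (g : 𝓢(ℝ, ℂ)) (x : ℝ) :
    ⟪a • ψ + U.fourierCalculus g ψ, U.appReal x (a • ψ + U.fourierCalculus g ψ)⟫_ℂ =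
      ∫ ξ, cexp (((ξ * x : ℝ) : ℂ) * I) *
        (((‖a + g (ξ / (2 * Real.pi))‖ ^ 2 : ℝ) : ℂ)) ∂(specMeasure U ψ) := by
  set μ := specMeasure U ψ with hμ
  set gt : ℝ → ℂ := fun ξ => g (ξ / (2 * Real.pi)) with hgt
  -- the four coefficients
  have c1 : ⟪ψ, U.appReal x ψ⟫_ℂ = ∫ ξ, cexp (((ξ * x : ℝ) : ℂ) * I) ∂μ :=
    inner_appReal_eq_integral_specMeasure U ψ x
  have c2 : ⟪ψ, U.appReal x (U.fourierCalculus g ψ)⟫_ℂ = ∫ ξ, cexp (((ξ * x : ℝ) : ℂ) * I) * gt ξ ∂μ :=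
    inner_appReal_fourierCalculus_eq_integral U g ψ x
  have c3 : ⟪U.fourierCalculus g ψ, U.appReal x ψ⟫_ℂ =
      ∫ ξ, cexp (((ξ * x : ℝ) : ℂ) * I) * conj (gt ξ) ∂μ := by
    rw [← inner_conj_symm, inner_appReal_left, inner_appReal_fourierCalculus_eq_integral,
      ← integral_conj]
    refine integral_congr_ae (ae_of_all _ fun ξ => ?_)
    simp only
    rw [map_mul, ← Complex.exp_conj, map_mul, Complex.conj_ofReal, Complex.conj_I]
    congr 2
    push_cast
    ring
  have c4 : ⟪U.fourierCalculus g ψ, U.appReal x (U.fourierCalculus g ψ)⟫_ℂ =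
      ∫ ξ, cexp (((ξ * x : ℝ) : ℂ) * I) * (conj (gt ξ) * gt ξ) ∂μ :=
    inner_fourierCalculus_appReal_fourierCalculus_eq_integral U g ψ x
  -- integrability of the four integrands (bounded by constants on a finite measure)
  have hb : ∀ ξ, ‖gt ξ‖ ≤ SchwartzMap.seminorm ℂ 0 0 g := fun ξ => norm_apply_le_seminorm g _
  have he : ∀ ξ : ℝ, ‖cexp (((ξ * x : ℝ) : ℂ) * I)‖ = 1 := fun ξ => by
    rw [Complex.norm_exp]; simp
  have i1 : Integrable (fun ξ : ℝ => cexp (((ξ * x : ℝ) : ℂ) * I)) μ :=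
    Integrable.of_bound (C := 1) (Continuous.aestronglyMeasurable (by fun_prop))
      (ae_of_all _ fun ξ => (he ξ).le)
  have i2 : Integrable (fun ξ : ℝ => cexp (((ξ * x : ℝ) : ℂ) * I) * gt ξ) μ :=
    Integrable.of_bound (C := SchwartzMap.seminorm ℂ 0 0 g)
      (Continuous.aestronglyMeasurable (by fun_prop))
      (ae_of_all _ fun ξ => by rw [norm_mul, he, one_mul]; exact hb ξ)
  have i3 : Integrable (fun ξ : ℝ => cexp (((ξ * x : ℝ) : ℂ) * I) * conj (gt ξ)) μ :=
    Integrable.of_bound (C := SchwartzMap.seminorm ℂ 0 0 g)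
      (Continuous.aestronglyMeasurable (by fun_prop))
      (ae_of_all _ fun ξ => by rw [norm_mul, he, one_mul, RCLike.norm_conj]; exact hb ξ)
  have i4 : Integrable (fun ξ : ℝ => cexp (((ξ * x : ℝ) : ℂ) * I) * (conj (gt ξ) * gt ξ)) μ :=
    Integrable.of_bound (C := SchwartzMap.seminorm ℂ 0 0 g * SchwartzMap.seminorm ℂ 0 0 g)
      (Continuous.aestronglyMeasurable (by fun_prop))
      (ae_of_all _ fun ξ => by
        rw [norm_mul, he, one_mul, norm_mul, RCLike.norm_conj]
        exact mul_le_mul (hb ξ) (hb ξ) (norm_nonneg _) (apply_nonneg _ _))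
  -- the integrand identity `e^{iξx} |a + g̃|² = ā a e + ā (e g̃) + a (e conj g̃) + e (conj g̃ · g̃)`
  have key : ∀ ξ : ℝ, cexp (((ξ * x : ℝ) : ℂ) * I) * (((‖a + g (ξ / (2 * Real.pi))‖ ^ 2 : ℝ) : ℂ)) =
      conj a * a * cexp (((ξ * x : ℝ) : ℂ) * I) + conj a * (cexp (((ξ * x : ℝ) : ℂ) * I) * gt ξ) +
        a * (cexp (((ξ * x : ℝ) : ℂ) * I) * conj (gt ξ)) +
        cexp (((ξ * x : ℝ) : ℂ) * I) * (conj (gt ξ) * gt ξ) := by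
    intro ξ
    have : (((‖a + g (ξ / (2 * Real.pi))‖ ^ 2 : ℝ) : ℂ)) = conj (a + gt ξ) * (a + gt ξ) := by
      rw [Complex.conj_mul']; push_cast; rfl
    rw [this, map_add]
    ring
  -- expand the left-hand side
  calc ⟪a • ψ + U.fourierCalculus g ψ, U.appReal x (a • ψ + U.fourierCalculus g ψ)⟫_ℂ
      = conj a * a * (∫ ξ, cexp (((ξ * x : ℝ) : ℂ) * I) ∂μ) +
          conj a * (∫ ξ, cexp (((ξ * x : ℝ) : ℂ) * I) * gt ξ ∂μ) +
          a * (∫ ξ, cexp (((ξ * x : ℝ) : ℂ) * I) * conj (gt ξ) ∂μ) +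
          ∫ ξ, cexp (((ξ * x : ℝ) : ℂ) * I) * (conj (gt ξ) * gt ξ) ∂μ := by
        rw [map_add, map_smul, inner_add_left, inner_add_right, inner_add_right, inner_smul_left,
          inner_smul_left, inner_smul_right, inner_smul_right, c1, c2, c3, c4]
        ring
    _ = ∫ ξ, (conj a * a * cexp (((ξ * x : ℝ) : ℂ) * I) + conj a * (cexp (((ξ * x : ℝ) : ℂ) * I) * gt ξ) +
          a * (cexp (((ξ * x : ℝ) : ℂ) * I) * conj (gt ξ)) +
          cexp (((ξ * x : ℝ) : ℂ) * I) * (conj (gt ξ) * gt ξ)) ∂μ := by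
        rw [integral_add ?_ i4, integral_add ?_ (i3.const_mul _),
          integral_add (i1.const_mul _) (i2.const_mul _), integral_const_mul, integral_const_mul,
          integral_const_mul]
        · exact (i1.const_mul _).add (i2.const_mul _)
        · exact ((i1.const_mul _).add (i2.const_mul _)).add (i3.const_mul _)
    _ = ∫ ξ, cexp (((ξ * x : ℝ) : ℂ) * I) * (((‖a + g (ξ / (2 * Real.pi))‖ ^ 2 : ℝ) : ℂ)) ∂μ :=
        integral_congr_ae (ae_of_all _ fun ξ => (key ξ).symm)


/-- **Spectral measure of a cut-off vector** (covariance of Stone–Bochner measures under the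
smooth functional calculus): `μ_{aψ + g(H/2π)ψ} = |a + g(·/2π)|² · μ_ψ`. With `a = 1`, `g ↦ -g`
this is the spectral measure of `(1 - g(H/2π))ψ`, which vanishes where `g(·/2π) = 1`. [folklore] -/
theorem specMeasure_smul_add_fourierCalculus (U : OneParameterUnitaryGroup H) (ψ : H) (a : ℂ)
    (g : 𝓢(ℝ, ℂ)) :
    specMeasure U (a • ψ + U.fourierCalculus g ψ) =
      (specMeasure U ψ).withDensity (fun ξ => ENNReal.ofReal (‖a + g (ξ / (2 * Real.pi))‖ ^ 2)) := by
  set μ := specMeasure U ψ with hμ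
  set ρ : ℝ → ℝ≥0∞ := fun ξ => ENNReal.ofReal (‖a + g (ξ / (2 * Real.pi))‖ ^ 2) with hρ
  have hρm : Measurable ρ := by
    rw [hρ]
    refine ENNReal.measurable_ofReal.comp ?_
    exact (continuous_const.add (g.continuous.comp (by fun_prop))).norm.pow 2 |>.measurable
  have hρb : ∀ ξ, ρ ξ ≤ ENNReal.ofReal ((‖a‖ + SchwartzMap.seminorm ℂ 0 0 g) ^ 2) := by
    intro ξ
    refine ENNReal.ofReal_le_ofReal (pow_le_pow_left₀ (norm_nonneg _) ?_ 2)
    exact (norm_add_le _ _).trans (by gcongr; exact norm_apply_le_seminorm g _)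
  haveI : IsFiniteMeasure (μ.withDensity ρ) := by
    refine isFiniteMeasure_withDensity (ne_of_lt ?_)
    calc ∫⁻ ξ, ρ ξ ∂μ ≤ ∫⁻ _, ENNReal.ofReal ((‖a‖ + SchwartzMap.seminorm ℂ 0 0 g) ^ 2) ∂μ :=
          lintegral_mono hρb
      _ = ENNReal.ofReal ((‖a‖ + SchwartzMap.seminorm ℂ 0 0 g) ^ 2) * μ univ := lintegral_const _
      _ < ⊤ := ENNReal.mul_lt_top ENNReal.ofReal_lt_top (measure_lt_top _ _)
  refine U.spectralMeasure_unique mulForm mulForm_nondegenerate _ (fun x => ?_)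
  rw [integral_withDensity_eq_integral_toReal_smul hρm (ae_of_all _ fun ξ => ENNReal.ofReal_lt_top),
    show U (Multiplicative.ofAdd x) = U.appReal x from rfl, inner_appReal_smul_add_fourierCalculus]
  refine integral_congr_ae (ae_of_all _ fun ξ => ?_)
  simp only [mulForm_apply, hρ]
  rw [ENNReal.toReal_ofReal (sq_nonneg _), Complex.real_smul, mul_comm]

/-- **Cut-off vectors have no spectral weight where the symbol vanishes**: if `a + g(ξ/2π) = 0`
for all `ξ ∈ S`, then `μ_{aψ + g(H/2π)ψ}(S) = 0`. (With `a = 1` and `-g(·/2π) = 1` on a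
neighbourhood of `[l', r']`, §7 then gives the uniform convergence of the Laplace–Fourier transforms
of `w = ψ - g(H/2π)ψ` on `[l', r']` — the "far" piece of the localisation step L6.) [folklore] -/
theorem specMeasure_smul_add_fourierCalculus_null (U : OneParameterUnitaryGroup H) (ψ : H) (a : ℂ)
    (g : 𝓢(ℝ, ℂ)) {S : Set ℝ} (hS : MeasurableSet S)
    (h0 : ∀ ξ ∈ S, a + g (ξ / (2 * Real.pi)) = 0) :
    specMeasure U (a • ψ + U.fourierCalculus g ψ) S = 0 := by
  rw [specMeasure_smul_add_fourierCalculus, withDensity_apply _ hS]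
  refine (lintegral_eq_zero_iff' ?_).2 ?_
  · refine (ENNReal.measurable_ofReal.comp ?_).aemeasurable
    exact (continuous_const.add (g.continuous.comp (by fun_prop))).norm.pow 2 |>.measurable
  · filter_upwards [self_mem_ae_restrict hS] with ξ hξ
    simp [h0 ξ hξ]

end Summit.AtomisticToContinuum.FouriersLaw.Theorems.MourreDissolution
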